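import Mathlib
import Literature.AlgebraicGeometry.Tropical.TorusCycles
import Summits.HodgeConjecture.HodgeConjecture.Theorems.TropicalWeilObstructionTropicalWeilVanishingTransportFrames
import Summits.HodgeConjecture.HodgeConjecture.Theorems.TropicalWeilObstructionTropicalWeilVanishingFlatObstructionLinAlg
import HarnessLib

/-!
# Crux `TropicalWeilVanishing` (stmt-HodgeConjecture-18478), line `identity_transfer` — isogeny
# transport of effective tropical cycles (for the registered stub `stub_transportToIdentity`)

Route `TropicalWeilObstruction` of `HodgeConjecture`. An effective tropical `p`-cycle on
`ℝᵍ / Q·ℤᵍ` in the certificate format `TropicalTorusCycle g p Q` (Mikhalkin–Zharkov Def. 4.2) consists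
of DISCRETE type data (weights `w_σ`, saturated integer frames `L_σ`, facet classes, facet
re-orderings, lattice shifts `k_{σ,i}`; the balancing certificate) and REAL data (vertices, edge
coefficient matrices `T_σ`, reference facets) tied by linear constraints in which `Q` enters only
through the facet identifications `v = r + Q k`. This file proves, on unbundled data, that the format
is stable under the three moves of the isogeny transport (Mikhalkin–Zharkov Prop. 4.3, Zharkov §2):

* `transport_typeData` — along an integer change of slope lattice `x ↦ F x` (`det F ≠ 0`) the type
  data transports: `F L_σ = L'_σ R_σ` with `L'_σ` saturated, `det R_σ > 0`, new weights
  `w_σ · det R_σ`, same classes / re-orderings, and the balancing certificate persists;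
* `transport_realData` — the real data of a realisation over `P`, scaled by `s > 0` and mapped by
  `F`, realise the transported type over any period matrix `Q'` with `F · (s P) = Q' · K`
  (`K` integral: push-forward to the coarser period lattice `Q' ℤᵍ ⊇ Q' K ℤᵍ`), with shifts `K k_{σ,i}`;
* `transport_weilFunctional` — for the Weil family (`g = 2n`, `p = n`, `F` commuting with `J`) the
  Weil functional `W = Σ_σ w_σ a_σ η_σ²` is multiplied by `sⁿ · det(A + iC)² ≠ 0`.

Mathlib + the frame algebra of `…TransportFrames`; no definition, no named fact, no sorry.

## References

* [MikhalkinZharkov2014Eigenwave] G. Mikhalkin, I. Zharkov, Tropical eigenwave and intermediate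
  Jacobians, LN UMI 15 (2014), Def. 4.2, Prop. 4.3, Def. 6.1.
* [Zharkov2020TropicalWeil] I. Zharkov, Tropical abelian varieties, Weil classes and the Hodge
  conjecture, arXiv:2002.02347 (2020), §2 (pp. 2–4).
-/

-- `Summit.HodgeConjecture.HodgeConjecture.…` is the mandated namespace (single-conjunct summit).
set_option linter.dupNamespace false

noncomputable section

open scoped BigOperators Matrix
open Matrix Literature.AlgebraicGeometry.Tropical

namespace Summit.HodgeConjecture.HodgeConjecture.Theorems.TropicalWeilVanishing

variable {g p Nc Nf : ℕ}

/-! ### Transport of the type data -/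

/-- **Type data transport along `x ↦ F x`.** Given effective weights `w_σ > 0`, saturated integer
frames `L_σ` and a balancing certificate (signed weighted frames cancel class by class in `⋀ᵖ ℤᵍ`),
and an integer `F` with `det F ≠ 0`: there are saturated frames `L'_σ`, integer `R_σ` with
`F L_σ = L'_σ R_σ`, `det R_σ > 0`, and effective weights `w'_σ = w_σ det R_σ` for which the balancing
certificate (same classes, same re-orderings) again holds.
[cite: MikhalkinZharkov2014Eigenwave, Def. 4.2 and Prop. 4.3] -/
theorem transport_typeData (w : Fin Nc → ℕ) (hw : ∀ σ, 0 < w σ)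
    (L : Fin Nc → Matrix (Fin g) (Fin p) ℤ) (hsat : ∀ σ, ∃ M : Matrix (Fin p) (Fin g) ℤ, M * L σ = 1)
    (cls : Fin Nc → Fin (p + 1) → Fin Nf) (prm : Fin Nc → Fin (p + 1) → Equiv.Perm (Fin p))
    (hbal : ∀ (f : Fin Nf) (S : Fin p → Fin g),
      (∑ σ, ∑ i : Fin (p + 1),
        if cls σ i = f then
          (w σ : ℤ) * (-1) ^ (i : ℕ) * ((Equiv.Perm.sign (prm σ i) : ℤˣ) : ℤ) * pluckerCoord (L σ) S
        else 0) = 0)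
    (F : Matrix (Fin g) (Fin g) ℤ) (hF : F.det ≠ 0) :
    ∃ (w' : Fin Nc → ℕ) (L' : Fin Nc → Matrix (Fin g) (Fin p) ℤ) (R : Fin Nc → Matrix (Fin p) (Fin p) ℤ),
      (∀ σ, 0 < w' σ) ∧ (∀ σ, ∃ M : Matrix (Fin p) (Fin g) ℤ, M * L' σ = 1) ∧
      (∀ σ, F * L σ = L' σ * R σ) ∧ (∀ σ, 0 < (R σ).det) ∧
      (∀ σ, ((w' σ : ℕ) : ℤ) = (w σ : ℤ) * (R σ).det) ∧
      ∀ (f : Fin Nf) (S : Fin p → Fin g),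
        (∑ σ, ∑ i : Fin (p + 1),
          if cls σ i = f then
            (w' σ : ℤ) * (-1) ^ (i : ℕ) * ((Equiv.Perm.sign (prm σ i) : ℤˣ) : ℤ) * pluckerCoord (L' σ) S
          else 0) = 0 := by
  classical
  -- re-saturate `F L_σ` cell by cell
  have hinj : ∀ (σ : Fin Nc) (x : Fin p → ℤ), (F * L σ) *ᵥ x = 0 → x = 0 := by
    intro σ x hx
    obtain ⟨M, hM⟩ := hsat σ
    obtain ⟨y, hy0, hFy⟩ | hall := Classical.em (∃ y ≠ (0 : Fin g → ℤ), F *ᵥ y = 0)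
    · exact absurd (Matrix.exists_mulVec_eq_zero_iff.1 ⟨y, hy0, hFy⟩) hF
    · have hLx : L σ *ᵥ x = 0 := by
        by_contra hne
        exact hall ⟨L σ *ᵥ x, hne, by rwa [Matrix.mulVec_mulVec]⟩
      have := congrArg (fun y => M *ᵥ y) hLx
      simpa [Matrix.mulVec_mulVec, hM] using this
  choose L' R hfac hdet hsat' using fun σ => exists_saturation (F * L σ) (hinj σ)
  refine ⟨fun σ => w σ * (R σ).det.toNat, L', R, ?_, hsat', hfac, hdet, ?_, ?_⟩
  · intro σ
    exact Nat.mul_pos (hw σ) (by have := hdet σ; omega)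
  · intro σ
    push_cast
    rw [Int.toNat_of_nonneg (hdet σ).le]
  · intro f S
    have h := balanced_transport (fun σ => (w σ : ℤ)) L cls
      (fun σ i => ((Equiv.Perm.sign (prm σ i) : ℤˣ) : ℤ)) hbal F L' R hfac f S
    simpa only [Nat.cast_mul, Int.natCast_toNat_eq_self.mpr (hdet _).le] using h

/-! ### Transport of the real data (scale, map by `F`, push forward to a coarser period lattice) -/

/-- Casting an integer matrix product to `ℝ`. [folklore] -/
theorem map_intCast_mul {α β γ : Type*} [Fintype β] (A : Matrix α β ℤ) (B : Matrix β γ ℤ) :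
    (A * B).map ((↑) : ℤ → ℝ) = A.map ((↑) : ℤ → ℝ) * B.map ((↑) : ℤ → ℝ) :=
  Matrix.map_mul (f := Int.castRingHom ℝ)

/-- **Real data transport.** Let `(v, T, r)` realise the type `(L, cls, prm, k)` over the period
matrix `P` (edges `v_{σ,j+1} - v_{σ,0} = L_σ T_σ e_j`, `det T_σ > 0`, facet identifications
`v_{σ, i.succAbove (π j)} = r_{cls σ i, j} + P k_{σ,i}`), let `F L_σ = L'_σ R_σ` with `det R_σ > 0`,
`s > 0`, and `F · (s P) = Q' · K` with `K` integral. Then `(F(s v), R_σ (s T_σ), F(s r))` realise the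
transported type `(L', cls, prm, K k)` over `Q'`: the homothety `x ↦ s x`, the linear map `x ↦ F x`
(slope lattice `ℤᵍ → F ℤᵍ`, re-saturated) and the push-forward along `ℝᵍ/Q'Kℤᵍ → ℝᵍ/Q'ℤᵍ`.
[cite: MikhalkinZharkov2014Eigenwave, Def. 4.2 and Prop. 4.3] [cite: Zharkov2020TropicalWeil, §2 (pp. 2–4)] -/
theorem transport_realData
    (L : Fin Nc → Matrix (Fin g) (Fin p) ℤ) (cls : Fin Nc → Fin (p + 1) → Fin Nf)
    (prm : Fin Nc → Fin (p + 1) → Equiv.Perm (Fin p)) (sh : Fin Nc → Fin (p + 1) → Fin g → ℤ)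
    (P : Matrix (Fin g) (Fin g) ℝ)
    (v : Fin Nc → Fin (p + 1) → Fin g → ℝ) (T : Fin Nc → Matrix (Fin p) (Fin p) ℝ)
    (ref : Fin Nf → Fin p → Fin g → ℝ)
    (hv : ∀ (σ : Fin Nc) (j : Fin p) (a : Fin g),
      v σ j.succ a - v σ 0 a = ∑ m, (L σ a m : ℝ) * T σ m j)
    (hT : ∀ σ, 0 < (T σ).det)
    (hfe : ∀ (σ : Fin Nc) (i : Fin (p + 1)) (j : Fin p) (a : Fin g),
      v σ (i.succAbove (prm σ i j)) a = ref (cls σ i) j a + ∑ b, P a b * (sh σ i b : ℝ))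
    (F : Matrix (Fin g) (Fin g) ℤ) (L' : Fin Nc → Matrix (Fin g) (Fin p) ℤ)
    (R : Fin Nc → Matrix (Fin p) (Fin p) ℤ) (hfac : ∀ σ, F * L σ = L' σ * R σ)
    (hR : ∀ σ, 0 < (R σ).det) (s : ℝ) (hs : 0 < s) (K : Matrix (Fin g) (Fin g) ℤ)
    (Q' : Matrix (Fin g) (Fin g) ℝ) (hK : F.map ((↑) : ℤ → ℝ) * (s • P) = Q' * K.map ((↑) : ℤ → ℝ)) :
    (∀ (σ : Fin Nc) (j : Fin p) (a : Fin g),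
        (F.map ((↑) : ℤ → ℝ) *ᵥ (s • v σ j.succ)) a - (F.map ((↑) : ℤ → ℝ) *ᵥ (s • v σ 0)) a =
          ∑ m, (L' σ a m : ℝ) * ((R σ).map ((↑) : ℤ → ℝ) * (s • T σ)) m j) ∧
    (∀ σ, 0 < ((R σ).map ((↑) : ℤ → ℝ) * (s • T σ)).det) ∧
    (∀ (σ : Fin Nc) (i : Fin (p + 1)) (j : Fin p) (a : Fin g),
        (F.map ((↑) : ℤ → ℝ) *ᵥ (s • v σ (i.succAbove (prm σ i j)))) a =
          (F.map ((↑) : ℤ → ℝ) *ᵥ (s • ref (cls σ i) j)) a +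
            ∑ b, Q' a b * ((K *ᵥ sh σ i) b : ℝ)) := by
  refine ⟨?_, ?_, ?_⟩
  · -- edges: `F (s e_j) = s (F L) T e_j = L' (R (s T)) e_j`
    intro σ j a
    have hfac' : ∀ m' : Fin p, ∑ c, (F a c : ℝ) * (L σ c m' : ℝ) = ∑ m, (L' σ a m : ℝ) * (R σ m m' : ℝ) := by
      intro m'
      have h := congrFun (congrFun (hfac σ) a) m'
      simp only [Matrix.mul_apply] at h
      exact_mod_cast h
    simp only [Matrix.mulVec, dotProduct, Matrix.map_apply, Pi.smul_apply, smul_eq_mul,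
      Matrix.mul_apply, Matrix.smul_apply]
    rw [← Finset.sum_sub_distrib]
    have step1 : ∑ c, ((F a c : ℝ) * (s * v σ j.succ c) - (F a c : ℝ) * (s * v σ 0 c)) =
        ∑ m', s * ((∑ c, (F a c : ℝ) * (L σ c m' : ℝ)) * T σ m' j) := by
      calc ∑ c, ((F a c : ℝ) * (s * v σ j.succ c) - (F a c : ℝ) * (s * v σ 0 c))
          = ∑ c, (F a c : ℝ) * s * (v σ j.succ c - v σ 0 c) :=
            Finset.sum_congr rfl fun c _ => by ring
        _ = ∑ c, (F a c : ℝ) * s * ∑ m', (L σ c m' : ℝ) * T σ m' j :=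
            Finset.sum_congr rfl fun c _ => by rw [hv σ j c]
        _ = ∑ c, ∑ m', s * ((F a c : ℝ) * (L σ c m' : ℝ) * T σ m' j) := by
            refine Finset.sum_congr rfl fun c _ => ?_
            rw [Finset.mul_sum]
            exact Finset.sum_congr rfl fun m' _ => by ring
        _ = ∑ m', ∑ c, s * ((F a c : ℝ) * (L σ c m' : ℝ) * T σ m' j) := Finset.sum_comm
        _ = ∑ m', s * ((∑ c, (F a c : ℝ) * (L σ c m' : ℝ)) * T σ m' j) := by
            refine Finset.sum_congr rfl fun m' _ => ?_
            rw [Finset.sum_mul, Finset.mul_sum]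
    rw [step1]
    simp_rw [hfac']
    calc ∑ m', s * ((∑ m, (L' σ a m : ℝ) * (R σ m m' : ℝ)) * T σ m' j)
        = ∑ m', ∑ m, (L' σ a m : ℝ) * ((R σ m m' : ℝ) * (s * T σ m' j)) := by
          refine Finset.sum_congr rfl fun m' _ => ?_
          rw [Finset.sum_mul, Finset.mul_sum]
          exact Finset.sum_congr rfl fun m _ => by ring
      _ = ∑ m, ∑ m', (L' σ a m : ℝ) * ((R σ m m' : ℝ) * (s * T σ m' j)) := Finset.sum_comm
      _ = ∑ m, (L' σ a m : ℝ) * ∑ m', (R σ m m' : ℝ) * (s * T σ m' j) := by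
          refine Finset.sum_congr rfl fun m _ => ?_
          rw [Finset.mul_sum]
  · -- orientation: `det (R (s T)) = det R · s^p · det T > 0`
    intro σ
    rw [Matrix.det_mul, Matrix.det_smul, Fintype.card_fin, ← Int.cast_det]
    exact mul_pos (by exact_mod_cast hR σ) (mul_pos (pow_pos hs p) (hT σ))
  · -- facets: `F (s (r + P k)) = F (s r) + (F (s P)) k = F (s r) + Q' (K k)`
    intro σ i j a
    have hK' : ∀ b : Fin g, ∑ c, (F a c : ℝ) * (s * P c b) = ∑ b', Q' a b' * (K b' b : ℝ) := by
      intro b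
      have h := congrFun (congrFun hK a) b
      simpa only [Matrix.mul_apply, Matrix.map_apply, Matrix.smul_apply, smul_eq_mul] using h
    simp only [Matrix.mulVec, dotProduct, Matrix.map_apply, Pi.smul_apply, smul_eq_mul]
    push_cast
    calc ∑ c, (F a c : ℝ) * (s * v σ (i.succAbove (prm σ i j)) c)
        = ∑ c, (F a c : ℝ) * (s * (ref (cls σ i) j c + ∑ b, P c b * (sh σ i b : ℝ))) :=
          Finset.sum_congr rfl fun c _ => by rw [hfe σ i j c]
      _ = ∑ c, ((F a c : ℝ) * (s * ref (cls σ i) j c) +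
            ∑ b, (F a c : ℝ) * (s * P c b) * (sh σ i b : ℝ)) := by
          refine Finset.sum_congr rfl fun c _ => ?_
          rw [mul_add, mul_add, Finset.mul_sum, Finset.mul_sum]
          congr 1
          exact Finset.sum_congr rfl fun b _ => by ring
      _ = ∑ c, (F a c : ℝ) * (s * ref (cls σ i) j c) +
            ∑ b, (∑ c, (F a c : ℝ) * (s * P c b)) * (sh σ i b : ℝ) := by
          rw [Finset.sum_add_distrib]
          congr 1
          rw [Finset.sum_comm]
          exact Finset.sum_congr rfl fun b _ => by rw [Finset.sum_mul]
      _ = ∑ c, (F a c : ℝ) * (s * ref (cls σ i) j c) +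
            ∑ b', Q' a b' * ∑ b, (K b' b : ℝ) * (sh σ i b : ℝ) := by
          congr 1
          simp_rw [hK', Finset.sum_mul, Finset.mul_sum]
          rw [Finset.sum_comm]
          exact Finset.sum_congr rfl fun b' _ => Finset.sum_congr rfl fun b _ => by ring

/-! ### The Weil family: `J`-commuting transports and the Weil functional -/

section Weil

variable {n : ℕ}

/-- **Block shape of a `J`-commuting integer matrix**: `F J = J F` forces `F = [[A, -C], [C, A]]`,
i.e. `F_{a+n, b+n} = F_{a, b}` and `F_{a, b+n} = -F_{a+n, b}`. [cite: Zharkov2020TropicalWeil, §2 (pp. 2–4)] -/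
theorem blocks_of_commute_weilJ (F : Matrix (Fin (2 * n)) (Fin (2 * n)) ℤ)
    (h : F.map ((↑) : ℤ → ℝ) * weilJ n = weilJ n * F.map ((↑) : ℤ → ℝ)) :
    (∀ a b : Fin n, F ⟨(a : ℕ) + n, by omega⟩ ⟨(b : ℕ) + n, by omega⟩ = F ⟨(a : ℕ), by omega⟩ ⟨(b : ℕ), by omega⟩) ∧
    (∀ a b : Fin n, F ⟨(a : ℕ), by omega⟩ ⟨(b : ℕ) + n, by omega⟩ = -F ⟨(a : ℕ) + n, by omega⟩ ⟨(b : ℕ), by omega⟩) := by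
  constructor
  · intro a b
    have e := TropicalWeilSupply.Negative.apply_add_add_of_commute h a b
    simp only [Matrix.map_apply] at e
    exact_mod_cast e
  · intro a b
    have e1 := TropicalWeilSupply.Negative.mul_weilJ_apply_left (F.map ((↑) : ℤ → ℝ)) ⟨(a : ℕ), by omega⟩ b
    have e2 : (weilJ n * F.map ((↑) : ℤ → ℝ)) ⟨(a : ℕ), by omega⟩ ⟨(b : ℕ), by omega⟩ =
        -(F.map ((↑) : ℤ → ℝ)) ⟨(a : ℕ) + n, by omega⟩ ⟨(b : ℕ), by omega⟩ := by
      have := weilJ_mulVec_apply_lo (fun c => (F.map ((↑) : ℤ → ℝ)) c ⟨(b : ℕ), by omega⟩) a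
      simpa [Matrix.mul_apply, Matrix.mulVec, dotProduct] using this
    rw [h] at e1
    rw [e1] at e2
    simp only [Matrix.map_apply] at e2
    exact_mod_cast e2

/-- **The Weil functional of a transported cycle.** With `F = [[A, -C], [C, A]]` integral,
`F L_σ = L'_σ R_σ`, new weights `w'_σ = w_σ det R_σ` and new edge matrices `R_σ (s T_σ)`:
`Σ_σ w'_σ a'_σ η(L'_σ)² = sⁿ · det(A + iC)² · Σ_σ w_σ a_σ η(L_σ)²` (`a = det T / n!`), because
`η(L'_σ) det R_σ = η(F L_σ) = det(A + iC) η(L_σ)`. [cite: Zharkov2020TropicalWeil, §2 (pp. 2–4)]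
[cite: MikhalkinZharkov2014Eigenwave, Prop. 4.3] -/
theorem transport_weilFunctional {Nc : ℕ} (w w' : Fin Nc → ℕ)
    (L L' : Fin Nc → Matrix (Fin (2 * n)) (Fin n) ℤ) (R : Fin Nc → Matrix (Fin n) (Fin n) ℤ)
    (T : Fin Nc → Matrix (Fin n) (Fin n) ℝ) (F : Matrix (Fin (2 * n)) (Fin (2 * n)) ℤ)
    (hF1 : ∀ a b : Fin n, F ⟨(a : ℕ) + n, by omega⟩ ⟨(b : ℕ) + n, by omega⟩ = F ⟨(a : ℕ), by omega⟩ ⟨(b : ℕ), by omega⟩)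
    (hF2 : ∀ a b : Fin n, F ⟨(a : ℕ), by omega⟩ ⟨(b : ℕ) + n, by omega⟩ = -F ⟨(a : ℕ) + n, by omega⟩ ⟨(b : ℕ), by omega⟩)
    (hfac : ∀ σ, F * L σ = L' σ * R σ) (hw' : ∀ σ, ((w' σ : ℕ) : ℤ) = (w σ : ℤ) * (R σ).det) (s : ℝ) :
    (∑ σ, ((w' σ : ℕ) : ℂ) *
        ((((R σ).map ((↑) : ℤ → ℝ) * (s • T σ)).det / (n.factorial : ℝ) : ℝ) : ℂ) *
        frameComplexDet n (L' σ) ^ 2) =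
      ((s ^ n : ℝ) : ℂ) *
        (Matrix.of fun k j : Fin n =>
          ((F ⟨(k : ℕ), by omega⟩ ⟨(j : ℕ), by omega⟩ : ℤ) : ℂ) +
            ((F ⟨(k : ℕ) + n, by omega⟩ ⟨(j : ℕ), by omega⟩ : ℤ) : ℂ) * Complex.I).det ^ 2 *
      ∑ σ, ((w σ : ℕ) : ℂ) * (((T σ).det / (n.factorial : ℝ) : ℝ) : ℂ) * frameComplexDet n (L σ) ^ 2 := by
  set D : ℂ := (Matrix.of fun k j : Fin n =>
    ((F ⟨(k : ℕ), by omega⟩ ⟨(j : ℕ), by omega⟩ : ℤ) : ℂ) +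
      ((F ⟨(k : ℕ) + n, by omega⟩ ⟨(j : ℕ), by omega⟩ : ℤ) : ℂ) * Complex.I).det with hD
  rw [Finset.mul_sum]
  refine Finset.sum_congr rfl fun σ _ => ?_
  -- `η(L') · det R = det(A + iC) · η(L)`
  have key : frameComplexDet n (L' σ) * ((R σ).det : ℂ) = D * frameComplexDet n (L σ) := by
    rw [← frameComplexDet_mul_right, ← hfac σ, hD, frameComplexDet_left_mul F hF1 hF2]
  have hw'σ : ((w' σ : ℕ) : ℂ) = ((w σ : ℕ) : ℂ) * ((R σ).det : ℂ) := by
    have := hw' σ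
    exact_mod_cast congrArg (fun z : ℤ => (z : ℂ)) this
  have hdet : ((R σ).map ((↑) : ℤ → ℝ) * (s • T σ)).det = ((R σ).det : ℝ) * (s ^ n * (T σ).det) := by
    rw [Matrix.det_mul, Matrix.det_smul, Fintype.card_fin, ← Int.cast_det]
  rw [hdet, hw'σ]
  simp only [Complex.ofReal_mul, Complex.ofReal_div, Complex.ofReal_pow, Complex.ofReal_intCast,
    Complex.ofReal_natCast]
  calc ((w σ : ℕ) : ℂ) * ((R σ).det : ℂ) *
        (((R σ).det : ℂ) * ((s : ℂ) ^ n * ((T σ).det : ℂ)) / (n.factorial : ℂ)) *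
        frameComplexDet n (L' σ) ^ 2
      = (s : ℂ) ^ n * (frameComplexDet n (L' σ) * ((R σ).det : ℂ)) ^ 2 *
          (((w σ : ℕ) : ℂ) * (((T σ).det : ℂ) / (n.factorial : ℂ))) := by ring
    _ = (s : ℂ) ^ n * D ^ 2 *
          (((w σ : ℕ) : ℂ) * (((T σ).det : ℂ) / (n.factorial : ℂ)) * frameComplexDet n (L σ) ^ 2) := by
        rw [key]; ring

end Weil

end Summit.HodgeConjecture.HodgeConjecture.Theorems.TropicalWeilVanishing

end
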